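import Summits.QuantumFields.GaugeBoot.DiagonalRPCoefficients
import Literature.MathematicalPhysics.QuantumFieldTheory.LatticeSiteRPMechanism
import HarnessLib

/-!
# Diagonal reflection positivity of symmetric finite-volume Wilson states (gauge-boot, L3(β))

HONEST FRAMING (cell `pub-gaugeboot`, page 1 of every file): the venture produces certified bounds
on lattice expectations at stated coupling, gauge group, dimension and torus size; NOT a mass gap,
NOT a continuum limit, NOT a string tension; NOT Yang–Mills-summit-bearing (barriers
`FixedCouplingUltralocality`, `PerturbativeInvisibility`).

**Theorem (`isReflectionPositiveFor_diag_ymSpecification`).** Let `G` be a compact second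
countable group, `ρ` a continuous matrix representation, `β ≥ 0`, `i ≠ j`. Let the finite link
set `Λ ⊂ ℤ^d` be symmetric under the diagonal swap `edgeSwap i j` and let the boundary condition
`η` be swap-symmetric (`configDiagSwapZd i j η = η`; e.g. `η = 1`). Then the finite-volume Wilson
state `γ_Λ(· | η) = ymSpecification ρ β Λ η` (product Haar measure on the links of `Λ`, glued with
`η` off `Λ`, tilted by `exp(-β S_Λ)`, `S_Λ` the Wilson action of all plaquettes touching `Λ`) is
REFLECTION POSITIVE in the hyperplane `x_i = x_j` in the sense of `ClassB.lean`:
`0 ≤ ∫ conj F(ΘU) · F(U) dγ_Λ(U | η)` for every bounded measurable `F` depending only on the links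
of the closed half `diagHalfEdges i j = {x_i ≥ x_j}`, i.e. `IsReflectionPositiveFor
(configDiagSwapZd i j) (diagHalfEdges i j) (ymSpecification ρ β Λ η)`. In particular
(`isReflectionPositiveFor_diag_ymSpecification_box`) this holds for the links based in the cube
`[-R, R]^d` with the unit boundary condition, for every `R` and every pair `i ≠ j`: Kazakov–Zheng's
third RP family (arXiv:2203.11360 §3.1, arXiv:2404.16925 §3.2, p. 10) IS a property of such symmetric
finite volumes — in contrast with the periodic torus, where it fails at every `β`
(`not_diagonalReflectionPositive`, `DiagonalRPTorusNegative.lean`). This is the optional brick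
L3(β) of the cell's plan: it shows the `diagRP` axiom of `ClassBState` (with the conventions of
`ClassB.lean`) is satisfied by genuine interacting finite-volume Wilson states at every `β ≥ 0`,
and it is the finite-volume input to the OPEN identification `ThermodynamicLimitIsClassB`
(limit points of symmetric boxes inherit diagonal RP by weak limits; under uniqueness of the
infinite-volume Gibbs state they coincide with the torus limit points). NO infinite-volume or
translation-invariance statement is made here. Also proved: the state is swap INVARIANT
(`ymSpecification_map_configDiagSwapZd`, every real `β`: `S_Λ(ΘU) = S_Λ(U)` and the swap relabels
the product Haar measure) and its `R_diag` blocks are positive semidefinite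
(`rDiagBlock_nonneg_ymSpecification`: `0 ≤ Σ_{a,b} c̄_a c_b ∫ (F_a∘Θ)‾ F_b dγ_Λ` for bounded measurable
half-space observables `F_a`, via `IsReflectionPositiveFor.sum_mul_conj_nonneg` of `ClassB.lean`).

**Proof** (Osterwalder–Seiler 1978 §2: reflection in a lattice hyperplane through sites, the
plaquettes CUT by the hyperplane being expanded as Gram kernels). With `Q` the swap-symmetric set
of plaquettes touching `Λ` (`DiagonalRPPlaquettes/Coefficients.lean`):
`∑_{p ∈ Q} Re tr ρ(U_p) = A(U) + A(ΘU) + M(U) + C(U)`, `β C(U) = ∑_ι a_ι(U) conj a_ι(ΘU)`, hence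
`e^{-β S_Λ(U)} conj F(ΘU) F(U) = e^{-β N #Q} · g(U) conj g(ΘU) · exp(∑_ι a_ι(U) conj a_ι(ΘU))`,
`g = F e^{β(A + M/2)}` (`weight_mul_eq`), with `g, a_ι` depending only on positive and mirror
links. On the configurations `Λ → G` of the finitely many links of `Λ` (product Haar measure; the
swap acts by the measure-preserving relabelling `boxSwap`, which FIXES the mirror links and moves
every positive link out of the closed half) this is the setting of the tree's abstract mechanism
with a shared block, `LatticeRP.integral_mul_conj_mul_exp_nonneg_of_shared` (crossing block
`C = ∅`, shared block = the mirror links of `Λ`); the kernel normaliser is positive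
(`normaliser_pos`).

References: K. Osterwalder, E. Seiler, Ann. Phys. 110 (1978) 440, §2; E. Seiler, LNP 159 (1982)
Ch. 2; J. Fröhlich, R. Israel, E. H. Lieb, B. Simon, CMP 62 (1978) 1, Thm. 2.1; V. Kazakov,
Z. Zheng, arXiv:2203.11360 §3.1; arXiv:2404.16925 §3.2 (p. 10). -/

noncomputable section

open MeasureTheory Complex
open scoped ComplexOrder ComplexConjugate
open Literature.Probability.LatticeModels (Site box mem_box glueWith glueWith_apply_mem
  glueWith_apply_not_mem measurable_glueWith)
open Literature.MathematicalPhysics.QuantumLattice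
open Literature.MathematicalPhysics.QuantumFieldTheory (haarProbability LatticeRP.splice
  LatticeRP.splice_eq_piecewise LatticeRP.integral_mul_conj_mul_exp_nonneg_of_shared)
open Literature.RepresentationTheory.CompactGroups

namespace Summit.QuantumFields.GaugeBoot

namespace DiagRP

variable {d N : ℕ} {i j : Fin d} {G : Type*} [Group G] [TopologicalSpace G] [IsTopologicalGroup G]
  [CompactSpace G] [MeasurableSpace G] [BorelSpace G] [SecondCountableTopology G]
variable (ρ : G →* Matrix (Fin N) (Fin N) ℂ)

/-! ## The observable `g` and the pointwise identity (any symmetric plaquette set `Q`) -/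

section Assembly

variable {Λ : Finset (ZdEdge d)}

variable (i j) in
/-- The observable `g = F · exp(β (A_Q + M_Q/2))` on configurations of `Λ` (glued with `η`), for a
finite plaquette set `Q` (`A_Q`, `M_Q` = its positive and mirror parts). -/
def gObs (β : ℝ) (Q : Finset (ZdPlaquette d)) (Λ : Finset (ZdEdge d)) (η : LGConfig d G)
    (F : LGConfig d G → ℂ) (ζ : ↥Λ → G) : ℂ :=
  F (glueWith Λ ζ η) * (Real.exp (β *
    (∑ p ∈ Q.filter (IsPosPlaq i j), plaquetteObs ρ p.1 p.2.1.1 p.2.1.2 (glueWith Λ ζ η) +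
      (∑ p ∈ Q.filter (IsMirrorPlaq i j), plaquetteObs ρ p.1 p.2.1.1 p.2.1.2 (glueWith Λ ζ η)) / 2)) : ℂ)

omit [MeasurableSpace G] [BorelSpace G] [SecondCountableTopology G] in
/-- **The pointwise identity**: for a `plaqSwap`-symmetric `Q`,
`e^{β ∑_{p ∈ Q} Re tr ρ(U_p)} conj F(ΘU) F(U) = g(ζ) conj g(boxSwap ζ) · exp(∑_ι a_ι(U) conj a_ι(ΘU))`,
`U = ζ η_{Λᶜ}`, `ΘU = (boxSwap ζ) η_{Λᶜ}`. -/
theorem weight_mul_eq (hρ : Continuous ρ) (hij : i ≠ j) {β : ℝ} (hβ : 0 ≤ β)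
    (hΛ : ∀ e ∈ Λ, edgeSwap i j e ∈ Λ) {η : LGConfig d G} (hη : configDiagSwapZd i j η = η)
    {Q : Finset (ZdPlaquette d)} (hQ : ∀ p ∈ Q, plaqSwap i j p ∈ Q) (F : LGConfig d G → ℂ)
    (ζ : ↥Λ → G) :
    (Real.exp (β * ∑ p ∈ Q, plaquetteObs ρ p.1 p.2.1.1 p.2.1.2 (glueWith Λ ζ η)) : ℂ) *
        (conj (F (configDiagSwapZd i j (glueWith Λ ζ η))) * F (glueWith Λ ζ η)) =
      gObs i j ρ β Q Λ η F ζ * conj (gObs i j ρ β Q Λ η F (boxSwap hΛ ζ)) *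
        Complex.exp (∑ ι, coeff i j ρ hρ β Q ι (glueWith Λ ζ η) *
          conj (coeff i j ρ hρ β Q ι (glueWith Λ (boxSwap hΛ ζ) η))) := by
  rw [← configDiagSwapZd_glueWith hΛ hη, sum_coeff_mul_conj ρ hρ hij hβ, gObs, gObs,
    ← configDiagSwapZd_glueWith hΛ hη, sum_mirror_configDiagSwapZd ρ hρ,
    sum_plaquetteObs_split ρ hρ hQ, ← Complex.ofReal_exp]
  set U := glueWith Λ ζ η
  set A1 := ∑ p ∈ Q.filter (IsPosPlaq i j), plaquetteObs ρ p.1 p.2.1.1 p.2.1.2 U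
  set A2 := ∑ p ∈ Q.filter (IsPosPlaq i j), plaquetteObs ρ p.1 p.2.1.1 p.2.1.2 (configDiagSwapZd i j U)
  set M1 := ∑ p ∈ Q.filter (IsMirrorPlaq i j), plaquetteObs ρ p.1 p.2.1.1 p.2.1.2 U
  set C1 := ∑ p ∈ Q.filter (IsCutPlaq i j), plaquetteObs ρ p.1 p.2.1.1 p.2.1.2 U
  simp only [map_mul, Complex.conj_ofReal]
  rw [show β * (A1 + A2 + M1 + C1) = β * (A1 + M1 / 2) + β * (A2 + M1 / 2) + β * C1 by ring,
    Real.exp_add, Real.exp_add]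
  push_cast
  ring

omit [CompactSpace G] in
/-- The observable `g` is measurable. -/
theorem measurable_gObs (hρ : Continuous ρ) (β : ℝ) (Q : Finset (ZdPlaquette d)) (η : LGConfig d G)
    {F : LGConfig d G → ℂ} (hF : Measurable F) : Measurable (gObs i j ρ β Q Λ η F) := by
  have hg : Measurable (glueWith Λ · η : (↥Λ → G) → LGConfig d G) := measurable_glueWith Λ η
  unfold gObs
  exact (hF.comp hg).mul (Complex.measurable_ofReal.comp
    ((((measurable_sum_plaquetteObs ρ hρ _).comp hg).add
      (((measurable_sum_plaquetteObs ρ hρ _).comp hg).div_const _)).const_mul β).exp)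

omit [MeasurableSpace G] [BorelSpace G] [SecondCountableTopology G] in
/-- The observable `g` is bounded. -/
theorem norm_gObs_le (hρ : Continuous ρ) {β : ℝ} (hβ : 0 ≤ β) (Q : Finset (ZdPlaquette d))
    (η : LGConfig d G) {F : LGConfig d G → ℂ} {CF : ℝ} (hFb : ∀ U, ‖F U‖ ≤ CF) (ζ : ↥Λ → G) :
    ‖gObs i j ρ β Q Λ η F ζ‖ ≤ |CF| * Real.exp (β * (2 * (N * Q.card))) := by
  rw [gObs, norm_mul, Complex.norm_real, Real.norm_eq_abs, abs_of_pos (Real.exp_pos _)]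
  refine mul_le_mul ((hFb _).trans (le_abs_self _)) ?_ (Real.exp_pos _).le (abs_nonneg _)
  refine Real.exp_le_exp.2 (mul_le_mul_of_nonneg_left ?_ hβ)
  have h1 := abs_sum_filter_plaquetteObs_le ρ hρ Q (IsPosPlaq i j) (glueWith Λ ζ η)
  have h2 := abs_sum_filter_plaquetteObs_le ρ hρ Q (IsMirrorPlaq i j) (glueWith Λ ζ η)
  rw [abs_le] at h1 h2
  linarith

omit [TopologicalSpace G] [IsTopologicalGroup G] [CompactSpace G] [MeasurableSpace G] [BorelSpace G]
  [SecondCountableTopology G] in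
/-- The observable `g` depends only on the positive and mirror links of `Λ`. -/
theorem dependsOn_gObs (hij : i ≠ j) (β : ℝ) (Q : Finset (ZdPlaquette d)) (η : LGConfig d G)
    {F : LGConfig d G → ℂ} (hFdep : DependsOn F (diagHalfEdges i j)) :
    DependsOn (gObs i j ρ β Q Λ η F)
      ((posBlock i j Λ ∪ ∅ ∪ mirrorBlock i j Λ : Finset ↥Λ) : Set ↥Λ) := by
  intro ζ ζ' h
  have hU := glueWith_eq_of_eq_on_blocks η h
  simp only [gObs, hFdep hU, sum_pos_congr ρ hij _ hU, sum_mirror_congr ρ _ hU]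

omit [MeasurableSpace G] [BorelSpace G] [SecondCountableTopology G] in
/-- The coefficient functions depend only on the positive and mirror links of `Λ`. -/
theorem dependsOn_coeff_glueWith (hρ : Continuous ρ) (hij : i ≠ j) (β : ℝ)
    (Q : Finset (ZdPlaquette d)) (η : LGConfig d G) (ι : ↥Q × Fin N × Fin N × Bool) :
    DependsOn (fun ζ : ↥Λ → G => coeff i j ρ hρ β Q ι (glueWith Λ ζ η))
      ((posBlock i j Λ ∪ ∅ ∪ mirrorBlock i j Λ : Finset ↥Λ) : Set ↥Λ) :=
  fun _ _ h => coeff_congr ρ hρ hij β _ ι (glueWith_eq_of_eq_on_blocks η h)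

/-- **Reflection positivity of a symmetric plaquette weight** (the core statement): for a
`plaqSwap`-symmetric finite plaquette set `Q`, a swap-symmetric link set `Λ` and boundary
condition `η`, `β ≥ 0` and `F` bounded measurable depending on the closed half,
`0 ≤ ∫ e^{β ∑_{p ∈ Q} Re tr ρ((ζη_{Λᶜ})_p)} conj F(Θ(ζ η_{Λᶜ})) F(ζ η_{Λᶜ}) dζ`
(product Haar measure on `Λ → G`). Both the DLR kernel (`Q` = plaquettes touching `Λ`) and a
free boundary condition (`Q` = plaquettes inside `Λ`) are instances. -/
theorem integral_exp_sum_mul_nonneg (hρ : Continuous ρ) (hij : i ≠ j) {β : ℝ} (hβ : 0 ≤ β)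
    (hΛ : ∀ e ∈ Λ, edgeSwap i j e ∈ Λ) {η : LGConfig d G} (hη : configDiagSwapZd i j η = η)
    {Q : Finset (ZdPlaquette d)} (hQ : ∀ p ∈ Q, plaqSwap i j p ∈ Q)
    {F : LGConfig d G → ℂ} (hF : Measurable F) {CF : ℝ} (hFb : ∀ U, ‖F U‖ ≤ CF)
    (hFdep : DependsOn F (diagHalfEdges i j)) :
    0 ≤ ∫ ζ, (Real.exp (β * ∑ p ∈ Q, plaquetteObs ρ p.1 p.2.1.1 p.2.1.2 (glueWith Λ ζ η)) : ℂ) *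
        (conj (F (configDiagSwapZd i j (glueWith Λ ζ η))) * F (glueWith Λ ζ η))
      ∂(Measure.pi fun _ : ↥Λ => haarProbability G) := by
  have hg : Measurable (glueWith Λ · η : (↥Λ → G) → LGConfig d G) := measurable_glueWith Λ η
  simp_rw [weight_mul_eq ρ hρ hij hβ hΛ hη hQ F]
  have h := LatticeRP.integral_mul_conj_mul_exp_nonneg_of_shared (haarProbability G)
    (mirrorBlock i j Λ) (posBlock i j Λ) ∅ (boxSwap hΛ) (measurePreserving_boxSwap hΛ)
    (fun ζ e he => boxSwap_apply_of_mem_mirrorBlock hΛ ζ e he)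
    (fun e he => dependsOn_boxSwap_apply hΛ e he) disjoint_mirrorBlock_posBlock
    (Finset.disjoint_empty_right _) (g := gObs i j ρ β Q Λ η F)
    (a := fun ι ζ => coeff i j ρ hρ β Q ι (glueWith Λ ζ η))
    (measurable_gObs ρ hρ β Q η hF) (fun ι => (measurable_coeff ρ hρ β Q ι).comp hg)
    (norm_gObs_le ρ hρ hβ Q η hFb) (fun ι ζ => norm_coeff_le ρ hρ β Q ι (glueWith Λ ζ η))
    (dependsOn_gObs ρ hij β Q η hFdep) (fun ι => dependsOn_coeff_glueWith ρ hρ hij β Q η ι)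
  simp only [LatticeRP.splice_eq_piecewise, Finset.piecewise_empty] at h
  rwa [integral_fun_fst (fun ζ : ↥Λ → G => gObs i j ρ β Q Λ η F ζ *
      conj (gObs i j ρ β Q Λ η F (boxSwap hΛ ζ)) *
      Complex.exp (∑ ι, coeff i j ρ hρ β Q ι (glueWith Λ ζ η) *
        conj (coeff i j ρ hρ β Q ι (glueWith Λ (boxSwap hΛ ζ) η)))),
    probReal_univ, one_smul] at h

/-- **Reflection positivity of the un-normalised DLR kernel**:
`0 ≤ ∫ e^{-β S_Λ(ζ η_{Λᶜ})} conj F(Θ(ζ η_{Λᶜ})) F(ζ η_{Λᶜ}) dζ` (product Haar measure on `Λ → G`;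
`Q` = the plaquettes touching `Λ`, `e^{-β S_Λ} = e^{-β N #Q} e^{β ∑_Q Re tr ρ(U_p)}`). -/
theorem integral_weight_mul_nonneg (hρ : Continuous ρ) (hij : i ≠ j) {β : ℝ} (hβ : 0 ≤ β)
    (hΛ : ∀ e ∈ Λ, edgeSwap i j e ∈ Λ) {η : LGConfig d G} (hη : configDiagSwapZd i j η = η)
    {F : LGConfig d G → ℂ} (hF : Measurable F) {CF : ℝ} (hFb : ∀ U, ‖F U‖ ≤ CF)
    (hFdep : DependsOn F (diagHalfEdges i j)) :
    0 ≤ ∫ ζ, (Real.exp (-β * wilsonBoundaryAction ρ Λ (glueWith Λ ζ η)) : ℂ) *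
        (conj (F (configDiagSwapZd i j (glueWith Λ ζ η))) * F (glueWith Λ ζ η))
      ∂(Measure.pi fun _ : ↥Λ => haarProbability G) := by
  have hQ : ∀ p ∈ plaquettesTouching Λ, plaqSwap i j p ∈ plaquettesTouching Λ :=
    fun p hp => plaqSwap_mem_plaquettesTouching hΛ hp
  have hsplit : ∀ ζ : ↥Λ → G, (Real.exp (-β * wilsonBoundaryAction ρ Λ (glueWith Λ ζ η)) : ℂ) =
      (Real.exp (-β * (N * (plaquettesTouching Λ).card)) : ℂ) *
        (Real.exp (β * ∑ p ∈ plaquettesTouching Λ,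
          plaquetteObs ρ p.1 p.2.1.1 p.2.1.2 (glueWith Λ ζ η)) : ℂ) := fun ζ => by
    rw [← Complex.ofReal_mul, ← Real.exp_add, wilsonBoundaryAction_eq]
    congr 2
    ring
  simp_rw [hsplit, mul_assoc]
  rw [integral_const_mul]
  exact mul_nonneg (Complex.zero_le_real.2 (Real.exp_pos _).le)
    (integral_exp_sum_mul_nonneg ρ hρ hij hβ hΛ hη hQ hF hFb hFdep)

end Assembly

/-! ## The theorem -/

section Main

/-- **Diagonal reflection positivity of symmetric finite-volume Wilson states** (Osterwalder–Seiler
1978 §2 mechanism; Kazakov–Zheng's third RP family, arXiv:2203.11360 §3.1, arXiv:2404.16925 §3.2, p. 10).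
For a compact second countable `G`, continuous `ρ`, `β ≥ 0`, `i ≠ j`, a finite link set `Λ`
symmetric under `edgeSwap i j` and a swap-symmetric boundary condition `η`, the lattice Yang–Mills
kernel `γ_Λ(· | η) = ymSpecification ρ β Λ η` is reflection positive in the hyperplane `x_i = x_j`:
`0 ≤ ∫ conj F(ΘU) F(U) dγ_Λ(U | η)` for all bounded measurable `F` depending only on the links of
the closed half `{x_i ≥ x_j}`. (On the periodic torus the same property FAILS:
`not_diagonalReflectionPositive`.) -/
theorem isReflectionPositiveFor_diag_ymSpecification (hρ : Continuous ρ) (hij : i ≠ j) {β : ℝ}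
    (hβ : 0 ≤ β) {Λ : Finset (ZdEdge d)} (hΛ : ∀ e ∈ Λ, edgeSwap i j e ∈ Λ) {η : LGConfig d G}
    (hη : configDiagSwapZd i j η = η) :
    IsReflectionPositiveFor (configDiagSwapZd i j) (diagHalfEdges i j) (ymSpecification ρ β Λ η) := by
  intro F hF hFb hFdep
  obtain ⟨CF, hFb⟩ := hFb
  have hg : Measurable (glueWith Λ · η : (↥Λ → G) → LGConfig d G) := measurable_glueWith Λ η
  have hw : Continuous fun U : LGConfig d G => Real.exp (-β * wilsonBoundaryAction ρ Λ U) :=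
    Real.continuous_exp.comp (continuous_const.mul (continuous_wilsonBoundaryAction ρ hρ Λ))
  have hΘm : Measurable (configDiagSwapZd (G := G) i j) :=
    measurable_pi_lambda _ fun e => measurable_pi_apply _
  have hH : Measurable fun U : LGConfig d G => conj (F (configDiagSwapZd i j U)) * F U :=
    (Complex.continuous_conj.measurable.comp (hF.comp hΘm)).mul hF
  have hZ : 0 < ∫ U, Real.exp (-β * wilsonBoundaryAction ρ Λ U)
      ∂((Measure.pi fun _ : ↥Λ => haarProbability G).map (glueWith Λ · η)) := by
    rw [integral_map hg.aemeasurable hw.aestronglyMeasurable]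
    exact normaliser_pos ρ hρ β Λ η
  unfold ymSpecification
  rw [integral_tilted, integral_map hg.aemeasurable]
  · simp_rw [Complex.real_smul, Complex.ofReal_div, div_eq_mul_inv, mul_comm (Complex.ofReal _)
      ((_ : ℂ)⁻¹), mul_assoc]
    rw [integral_const_mul]
    refine mul_nonneg ?_ (integral_weight_mul_nonneg ρ hρ hij hβ hΛ hη hF hFb hFdep)
    rw [← Complex.ofReal_inv]
    exact Complex.zero_le_real.2 (inv_nonneg.2 hZ.le)
  · exact ((hw.measurable.div_const _).smul hH).aestronglyMeasurable

omit [TopologicalSpace G] [IsTopologicalGroup G] [CompactSpace G] [MeasurableSpace G] [BorelSpace G]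
  [SecondCountableTopology G] in
/-- The unit boundary condition is swap-symmetric. -/
theorem configDiagSwapZd_one : configDiagSwapZd (G := G) i j 1 = 1 := rfl

omit [Group G] [TopologicalSpace G] [IsTopologicalGroup G] [CompactSpace G] [MeasurableSpace G]
  [BorelSpace G] [SecondCountableTopology G] in
/-- The set of links based in the cube `[-R, R]^d` is swap-symmetric. -/
theorem edgeSwap_mem_box_product (R : ℕ) (e : ZdEdge d)
    (he : e ∈ box d R ×ˢ (Finset.univ : Finset (Fin d))) :
    edgeSwap i j e ∈ box d R ×ˢ (Finset.univ : Finset (Fin d)) := by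
  rw [Finset.mem_product] at he ⊢
  refine ⟨?_, Finset.mem_univ _⟩
  have h := mem_box.1 he.1
  exact mem_box.2 fun k => by simpa [edgeSwap] using h (Equiv.swap i j k)

/-- **Corollary: the Wilson state of the cube `[-R, R]^d` with unit boundary condition is
reflection positive in every diagonal hyperplane `x_i = x_j`** (`β ≥ 0`, `i ≠ j`; the link set is
all positively oriented links based in the cube). -/
theorem isReflectionPositiveFor_diag_ymSpecification_box (hρ : Continuous ρ) (hij : i ≠ j) {β : ℝ}
    (hβ : 0 ≤ β) (R : ℕ) :
    IsReflectionPositiveFor (configDiagSwapZd i j) (diagHalfEdges i j)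
      (ymSpecification ρ β (box d R ×ˢ (Finset.univ : Finset (Fin d))) (1 : LGConfig d G)) :=
  isReflectionPositiveFor_diag_ymSpecification ρ hρ hij hβ (fun e he => edgeSwap_mem_box_product R e he)
    configDiagSwapZd_one

end Main

/-! ## Swap invariance of the action and of the state -/

omit [MeasurableSpace G] [BorelSpace G] [SecondCountableTopology G] in
/-- A sum of plaquette observables over a `plaqSwap`-symmetric set is swap invariant. -/
theorem sum_plaquetteObs_configDiagSwapZd (hρ : Continuous ρ) {Q : Finset (ZdPlaquette d)}
    (hQ : ∀ p ∈ Q, plaqSwap i j p ∈ Q) (U : LGConfig d G) :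
    ∑ p ∈ Q, plaquetteObs ρ p.1 p.2.1.1 p.2.1.2 (configDiagSwapZd i j U) =
      ∑ p ∈ Q, plaquetteObs ρ p.1 p.2.1.1 p.2.1.2 U :=
  Finset.sum_nbij' (plaqSwap i j) (plaqSwap i j) (fun p hp => hQ p hp) (fun p hp => hQ p hp)
    (fun p _ => plaqSwap_plaqSwap i j p) (fun p _ => plaqSwap_plaqSwap i j p)
    fun p _ => plaquetteObs_configDiagSwapZd ρ hρ p U

omit [MeasurableSpace G] [BorelSpace G] [SecondCountableTopology G] in
/-- **The boundary Wilson action of a symmetric link set is swap invariant**: `S_Λ(ΘU) = S_Λ(U)`. -/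
theorem wilsonBoundaryAction_configDiagSwapZd (hρ : Continuous ρ) {Λ : Finset (ZdEdge d)}
    (hΛ : ∀ e ∈ Λ, edgeSwap i j e ∈ Λ) (U : LGConfig d G) :
    wilsonBoundaryAction ρ Λ (configDiagSwapZd i j U) = wilsonBoundaryAction ρ Λ U := by
  rw [wilsonBoundaryAction_eq, wilsonBoundaryAction_eq,
    sum_plaquetteObs_configDiagSwapZd ρ hρ (fun p hp => plaqSwap_mem_plaquettesTouching hΛ hp)]

omit [Group G] [TopologicalSpace G] [IsTopologicalGroup G] [CompactSpace G] [BorelSpace G]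
  [SecondCountableTopology G] in
/-- The swap of configurations is measurable. -/
theorem measurable_configDiagSwapZd : Measurable (configDiagSwapZd (G := G) i j) :=
  measurable_pi_lambda _ fun _ => measurable_pi_apply _

/-- **Swap invariance of the finite-volume state, integral form**: for a symmetric link set and
boundary condition, `∫ F(ΘU) dγ_Λ(U | η) = ∫ F dγ_Λ(· | η)` for every measurable real `F`
(every real `β`). -/
theorem integral_comp_configDiagSwapZd_ymSpecification (hρ : Continuous ρ) (β : ℝ)
    {Λ : Finset (ZdEdge d)} (hΛ : ∀ e ∈ Λ, edgeSwap i j e ∈ Λ) {η : LGConfig d G}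
    (hη : configDiagSwapZd i j η = η) {F : LGConfig d G → ℝ} (hF : Measurable F) :
    ∫ U, F (configDiagSwapZd i j U) ∂(ymSpecification ρ β Λ η) =
      ∫ U, F U ∂(ymSpecification ρ β Λ η) := by
  rw [integral_ymSpecification ρ hρ β Λ (F := fun U => F (configDiagSwapZd i j U))
      (hF.comp measurable_configDiagSwapZd) η, integral_ymSpecification ρ hρ β Λ hF η]
  congr 1
  have h1 : ∀ ζ : ↥Λ → G, F (configDiagSwapZd i j (glueWith Λ ζ η)) *
      Real.exp (-β * wilsonBoundaryAction ρ Λ (glueWith Λ ζ η)) =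
      (fun ζ' : ↥Λ → G => F (glueWith Λ ζ' η) *
        Real.exp (-β * wilsonBoundaryAction ρ Λ (glueWith Λ ζ' η))) (boxSwap hΛ ζ) := by
    intro ζ
    simp only
    rw [← wilsonBoundaryAction_configDiagSwapZd ρ hρ hΛ (glueWith Λ ζ η),
      configDiagSwapZd_glueWith hΛ hη]
  have hm : Measurable fun ζ' : ↥Λ → G => F (glueWith Λ ζ' η) *
      Real.exp (-β * wilsonBoundaryAction ρ Λ (glueWith Λ ζ' η)) :=
    (hF.comp (measurable_glueWith Λ η)).mul (((continuous_wilsonBoundaryAction ρ hρ Λ).measurable.comp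
      (measurable_glueWith Λ η)).const_mul _).exp
  simp_rw [h1]
  rw [← integral_map (measurePreserving_boxSwap hΛ).measurable.aemeasurable hm.aestronglyMeasurable,
    (measurePreserving_boxSwap hΛ).map_eq]

/-- **Swap invariance of the finite-volume Wilson state**: for a symmetric link set `Λ` and a
symmetric boundary condition `η`, `γ_Λ(· | η) ∘ Θ⁻¹ = γ_Λ(· | η)` (every real `β`). -/
theorem ymSpecification_map_configDiagSwapZd (hρ : Continuous ρ) (β : ℝ) {Λ : Finset (ZdEdge d)}
    (hΛ : ∀ e ∈ Λ, edgeSwap i j e ∈ Λ) {η : LGConfig d G} (hη : configDiagSwapZd i j η = η) :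
    (ymSpecification ρ β Λ η).map (configDiagSwapZd i j) = ymSpecification ρ β Λ η := by
  haveI := isProbabilityMeasure_ymSpecification ρ hρ β Λ η
  haveI : IsProbabilityMeasure ((ymSpecification ρ β Λ η).map (configDiagSwapZd (G := G) i j)) :=
    Measure.isProbabilityMeasure_map measurable_configDiagSwapZd.aemeasurable
  refine Measure.ext fun A hA => ?_
  have h : ((ymSpecification ρ β Λ η).map (configDiagSwapZd i j)).real A =
      (ymSpecification ρ β Λ η).real A := by
    rw [← integral_indicator_one hA, ← integral_indicator_one hA,
      integral_map (f := A.indicator (1 : LGConfig d G → ℝ)) measurable_configDiagSwapZd.aemeasurable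
        ((measurable_one.indicator hA).aestronglyMeasurable)]
    exact integral_comp_configDiagSwapZd_ymSpecification ρ hρ β hΛ hη
      (F := A.indicator (1 : LGConfig d G → ℝ)) (measurable_one.indicator hA)
  exact (ENNReal.toReal_eq_toReal_iff' (measure_ne_top _ _) (measure_ne_top _ _)).1 h

/-- The swap preserves the finite-volume state (as a `MeasurePreserving` statement). -/
theorem measurePreserving_configDiagSwapZd_ymSpecification (hρ : Continuous ρ) (β : ℝ)
    {Λ : Finset (ZdEdge d)} (hΛ : ∀ e ∈ Λ, edgeSwap i j e ∈ Λ) {η : LGConfig d G}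
    (hη : configDiagSwapZd i j η = η) :
    MeasurePreserving (configDiagSwapZd i j) (ymSpecification ρ β Λ η) (ymSpecification ρ β Λ η) :=
  ⟨measurable_configDiagSwapZd, ymSpecification_map_configDiagSwapZd ρ hρ β hΛ hη⟩

/-! ## The diagonal RP blocks of the finite-volume state -/

/-- **`R_diag` blocks of a symmetric finite-volume Wilson state are positive semidefinite**
(`β ≥ 0`, `i ≠ j`): for bounded measurable `F_1, …, F_n` depending only on the links of the closed
half `{x_i ≥ x_j}` and every `c ∈ ℂ^n`, `0 ≤ Σ_{a,b} c̄_a c_b ∫ (F_a∘Θ)‾ F_b dγ_Λ(· | η)` — the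
finite-volume (Class-A-style) justification of Kazakov–Zheng's third family of positivity
blocks for SYMMETRIC boxes (NOT for the torus: `not_diagonalReflectionPositive`). -/
theorem rDiagBlock_nonneg_ymSpecification (hρ : Continuous ρ) (hij : i ≠ j) {β : ℝ} (hβ : 0 ≤ β)
    {Λ : Finset (ZdEdge d)} (hΛ : ∀ e ∈ Λ, edgeSwap i j e ∈ Λ) {η : LGConfig d G}
    (hη : configDiagSwapZd i j η = η) {n : ℕ} (F : Fin n → LGConfig d G → ℂ)
    (hF : ∀ a, Measurable (F a)) (hFb : ∀ a, ∃ C : ℝ, ∀ U, ‖F a U‖ ≤ C)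
    (hFS : ∀ a, DependsOn (F a) (diagHalfEdges i j)) (c : Fin n → ℂ) :
    0 ≤ ∑ a, ∑ b, (starRingEnd ℂ) (c a) * c b *
      ∫ U, (starRingEnd ℂ) (F a (configDiagSwapZd i j U)) * F b U ∂(ymSpecification ρ β Λ η) := by
  haveI := isProbabilityMeasure_ymSpecification ρ hρ β Λ η
  exact (isReflectionPositiveFor_diag_ymSpecification ρ hρ hij hβ hΛ hη).sum_mul_conj_nonneg
    measurable_configDiagSwapZd F hF hFb hFS c

end DiagRP

end Summit.QuantumFields.GaugeBoot
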